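import Literature.NumberTheory.GaloisRepresentations.LocalGaloisGroupFrobeniusProofs
import Literature.NumberTheory.GaloisRepresentations.WeilGroup
import Mathlib.FieldTheory.Finite.Basic
import Mathlib.FieldTheory.Normal.Closure
import Mathlib.Topology.Algebra.OpenSubgroup
import HarnessLib

/-!
# Density of the Weil group in `Γ_F` (discharge of `WeilGroup.denseRange_toAbsGalois`;
trunk GalRep, item C7)

D-0014 keeps `Literature/` sorry-free by stating cited results as named facts `def X : Prop`.
This second sibling proof file of `Literature.NumberTheory.GaloisRepresentations.WeilGroup` proves

* `Literature.WeilGroup.denseRange_toAbsGalois_holds : WeilGroup.denseRange_toAbsGalois F` — the Weil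
  group `W_F = {σ | σ acts on S ⧸ 𝔓 as an integral power of x ↦ x ^ q_F}` is dense in
  `Γ_F = Gal(F̄/F)`, for every non-archimedean local field `F` (every characteristic),

the last hypothesis, besides local class field theory itself, of the assembly of the local Artin
map in `LocalClassFieldTheoryProofs.lean` (Tate, *Number theoretic background*, (1.4.1): "`W_F` is
dense in `Γ_F`").

## Proof

Fix `σ ∈ Γ_F` and a basic Krull neighbourhood `σ · N`, `N = Gal(F̄/L)` for a finite normal `L/F`
(`krullTopology_mem_nhds_one_iff_of_normal`); `N` is an open normal subgroup of finite index `d`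
of the compact group `Γ_F` (`Literature.NumberTheory.GaloisRepresentations.absoluteGaloisGroup_compactSpace`).  Everything happens in the
residue field `κ = S ⧸ 𝔓` of `S = absIntegers 𝒪[F] F` (`𝔓` maximal and `Γ_F`-stable:
`LocalGaloisGroupHenselProofs`, `LocalGaloisGroupProofs`), an algebraic extension of
`k₁ = 𝒪[F] ⧸ 𝔓 ∩ 𝒪[F]` (`#k₁ = q_F`):

1. `exists_monic_eval_eq_zero_of_forall_smul_eq`, `mk_pow_residueFieldCard_pow_factorial_index`:
   an `N`-invariant `a ∈ S` is a root of `∏_{b ∈ Γ_F a} (X - b)`, monic of degree `≤ d` with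
   `Γ_F`-invariant coefficients; residues of `Γ_F`-invariants lie in `k₁`
   (`exists_sub_algebraMap_mem_absMaximalIdeal_of_forall_smul_eq`, file
   `LocalGaloisGroupFrobeniusProofs`), so `ā` has degree `≤ d` over `k₁` and `ā ^ (q ^ d!) = ā`
   (`pow_card_pow_factorial_eq_of_monic`).  Hence the residues of the `N`-invariants form a
   *finite* `σ`-stable set generating a finite subfield `k' ⊆ κ`.
2. `exists_forall_mk_smul_eq_pow`: `σ` induces a `k₁`-automorphism of the finite field `k'`, which
   is a power `Frob ^ n` of `x ↦ x ^ q_F` (Mathlib `FiniteField.bijective_frobeniusAlgHom_pow`).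
3. `exists_mem_forall_mk_smul_eq`: a ring automorphism of `κ` fixing the residues of the
   `N`-invariants is induced by some `τ ∈ N` — Mathlib's profinite
   `Ideal.Quotient.stabilizerHom_surjective_of_profinite` for the compact group `N` acting
   continuously on the discrete ring `S` with ring of invariants `S^N`.
4. Apply 3 to `β = ρ(σ)⁻¹ ∘ Frob ^ n` (by 2 it fixes those residues): `σ τ` acts on `κ` as
   `Frob ^ n`, i.e. `IsFrobPow (σ τ) n`, so `σ τ ∈ W_F ∩ σ N`.

This is the classical argument "`D_𝔓 ↠ Gal(κ/k)` and the Galois group of a finite residue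
extension is generated by the Frobenius" (Serre, *Local Fields*, Ch. I §7, Prop. 20–22, §8),
organised so that no residue field of the finite levels `L` is needed.

## References

* J. Tate, *Number theoretic background*, Proc. Sympos. Pure Math. XXXIII (Corvallis 1977),
  Part 2, AMS 1979, (1.4.1).  [Corvallis1979]
* J.-P. Serre, *Local Fields*, GTM 67, Springer 1979, Ch. I §7 (Prop. 20–22), §8.
  [SerreLocalFields1979]
* J. Neukirch, *Algebraic Number Theory*, Springer 1999, Ch. I §9, Prop. (9.4). [NeukirchANT1999]
-/

noncomputable section

open scoped Pointwise Valued
open ValuativeRel Field Polynomial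

namespace Literature.NumberTheory.GaloisRepresentations

open GaloisRepresentations.IsNonarchimedeanLocalField

variable (F : Type*) [Field F] [ValuativeRel F] [TopologicalSpace F] [IsNonarchimedeanLocalField F]

/-! ### Residues of invariants under an open normal subgroup -/

/-- An element of a field containing a finite field `k` (through `i : k →+* K`) which is a root of
a monic polynomial of degree `≤ d` with coefficients in `i(k)` satisfies `x ^ (#k ^ d !) = x`:
`k(x)` is a field with `#k ^ e` elements, `e ≤ d`.
Ref: Serre, *Local Fields* (1979), Ch. I §8 (finite residue extensions). [folklore] -/
theorem pow_card_pow_factorial_eq_of_monic {k K : Type*} [Field k] [Fintype k] [Field K]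
    [Algebra k K] {d : ℕ} (p : k[X]) (hp : p.Monic) (hpd : p.natDegree ≤ d) (x : K)
    (hx : aeval x p = 0) : x ^ Fintype.card k ^ d.factorial = x := by
  classical
  have hint : IsIntegral k x := ⟨p, hp, hx⟩
  set Kx : IntermediateField k K := IntermediateField.adjoin k ({x} : Set K) with hKx
  haveI : FiniteDimensional k Kx := IntermediateField.adjoin.finiteDimensional hint
  haveI : Finite Kx := Module.finite_of_finite k
  letI : Fintype Kx := Fintype.ofFinite Kx
  set e := Module.finrank k Kx with he
  have he1 : e = (minpoly k x).natDegree := IntermediateField.adjoin.finrank hint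
  have hed : e ≤ d := by
    rw [he1]
    exact (natDegree_le_of_dvd (minpoly.dvd k x hx) hp.ne_zero).trans hpd
  have hepos : 0 < e := Module.finrank_pos
  -- `x ^ (q ^ e) = x` in the finite field `k(x)`
  have hcard : Fintype.card Kx = Fintype.card k ^ e := Module.card_eq_pow_finrank
  have hxe : x ^ Fintype.card k ^ e = x := by
    have h := FiniteField.pow_card (⟨x, IntermediateField.mem_adjoin_simple_self k x⟩ : Kx)
    rw [hcard] at h
    exact congrArg (fun y : Kx => (y : K)) h
  -- iterate: `e ∣ d !`
  have key : ∀ m : ℕ, x ^ (Fintype.card k ^ e) ^ m = x := fun m => by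
    induction m with
    | zero => simp
    | succ m ih => rw [pow_succ, pow_mul, ih, hxe]
  obtain ⟨m, hm⟩ := Nat.dvd_factorial hepos hed
  rw [hm, pow_mul, key]

omit [TopologicalSpace F] [IsNonarchimedeanLocalField F] in
/-- **Invariants under a finite-index subgroup are integral of bounded degree over the full
invariants.**  For `N ≤ Γ_F` of finite index `d` and an `N`-invariant `a ∈ S`, the polynomial
`∏_{b ∈ Γ_F a} (X - b)` over the (finite) orbit of `a` is monic of degree `≤ d`, kills `a`, and
has `Γ_F`-invariant coefficients.
Ref: Neukirch, *Algebraic Number Theory* (1999), Ch. I §9 (Hilbert theory set-up). [folklore] -/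
theorem exists_monic_eval_eq_zero_of_forall_smul_eq (N : Subgroup (absoluteGaloisGroup F))
    [N.FiniteIndex] (a : absIntegers 𝒪[F] F) (ha : ∀ τ ∈ N, τ • a = a) :
    ∃ p : Polynomial (absIntegers 𝒪[F] F), p.Monic ∧ p.natDegree ≤ N.index ∧ p.eval a = 0 ∧
      ∀ n, ∀ σ : absoluteGaloisGroup F, σ • p.coeff n = p.coeff n := by
  classical
  -- the orbit of `a` is finite, of cardinality `[Γ_F : Stab a] ≤ [Γ_F : N]`
  have hle : N ≤ MulAction.stabilizer (absoluteGaloisGroup F) a := fun τ hτ => ha τ hτ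
  haveI : (MulAction.stabilizer (absoluteGaloisGroup F) a).FiniteIndex :=
    Subgroup.finiteIndex_of_le hle
  have hfin : (MulAction.orbit (absoluteGaloisGroup F) a).Finite := by
    apply Set.finite_of_ncard_ne_zero
    rw [← MulAction.index_stabilizer]
    exact Subgroup.FiniteIndex.index_ne_zero
  set O : Finset (absIntegers 𝒪[F] F) := hfin.toFinset with hO
  have hcard : O.card ≤ N.index := by
    rw [hO, ← Set.ncard_eq_toFinset_card _ hfin, ← MulAction.index_stabilizer]
    exact Subgroup.index_antitone hle
  refine ⟨∏ b ∈ O, (X - C b), monic_prod_of_monic _ _ fun b _ => monic_X_sub_C b, ?_, ?_, ?_⟩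
  · rw [natDegree_prod_of_monic _ _ fun b _ => monic_X_sub_C b]
    simpa using hcard
  · rw [eval_prod]
    refine Finset.prod_eq_zero (i := a) ?_ (by simp)
    rw [hO, Set.Finite.mem_toFinset]
    exact MulAction.mem_orbit_self a
  · intro n σ
    rw [← Polynomial.coeff_smul, Finset.smul_prod']
    congr 1
    -- `σ` permutes the orbit
    refine Finset.prod_nbij (fun b => σ • b) (fun b hb => ?_)
      (fun b _ c _ h => smul_left_cancel σ h)
      (fun c hc => ?_) (fun b _ => by rw [smul_sub, Polynomial.smul_X, Polynomial.smul_C])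
    · rw [hO, Set.Finite.mem_toFinset] at hb ⊢
      obtain ⟨τ, rfl⟩ := MulAction.mem_orbit_iff.mp hb
      exact MulAction.mem_orbit_iff.mpr ⟨σ * τ, mul_smul σ τ a⟩
    · refine ⟨σ⁻¹ • c, ?_, smul_inv_smul σ c⟩
      rw [hO, Finset.mem_coe, Set.Finite.mem_toFinset] at hc
      rw [hO, Finset.mem_coe, Set.Finite.mem_toFinset]
      obtain ⟨τ, rfl⟩ := MulAction.mem_orbit_iff.mp hc
      exact MulAction.mem_orbit_iff.mpr ⟨σ⁻¹ * τ, mul_smul σ⁻¹ τ a⟩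


/-- **Residues of invariants have bounded degree.**  For `N ≤ Γ_F` of finite index `d` and an
`N`-invariant absolute integer `a`, `ā ^ (q_F ^ d !) = ā` in `S ⧸ 𝔓`: the polynomial of
`exists_monic_eval_eq_zero_of_forall_smul_eq` has `Γ_F`-invariant coefficients, whose residues
lie in `𝓀[F]` (`exists_sub_algebraMap_mem_absMaximalIdeal_of_forall_smul_eq`), so `ā` has degree
`≤ d` over `𝓀[F]` and `pow_card_pow_factorial_eq_of_monic` applies.
Ref: Serre, *Local Fields* (1979), Ch. I §7, Prop. 20–21 (the residue extension of a finite
extension is finite). [folklore] -/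
theorem mk_pow_residueFieldCard_pow_factorial_index (N : Subgroup (absoluteGaloisGroup F))
    [N.FiniteIndex] (a : absIntegers 𝒪[F] F) (ha : ∀ τ ∈ N, τ • a = a) :
    Ideal.Quotient.mk (absMaximalIdeal F) a ^ residueFieldCard F ^ N.index.factorial =
      Ideal.Quotient.mk (absMaximalIdeal F) a := by
  classical
  -- the fields `κ = S ⧸ 𝔓` and `k₁ = 𝒪[F] ⧸ 𝔓 ∩ 𝒪[F]` (`#k₁ = q_F`)
  haveI h𝔓 : (absMaximalIdeal F).IsMaximal := absMaximalIdeal_isMaximal_holds F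
  letI := Ideal.Quotient.field (absMaximalIdeal F)
  haveI : ((absMaximalIdeal F).under 𝒪[F]).IsMaximal := Ideal.IsMaximal.under 𝒪[F] _
  letI := Ideal.Quotient.field ((absMaximalIdeal F).under 𝒪[F])
  haveI : Finite (𝒪[F] ⧸ (absMaximalIdeal F).under 𝒪[F]) := Nat.finite_of_card_ne_zero (by
    rw [card_quotient_under_absMaximalIdeal_holds F]
    exact residueFieldCard_ne_zero F)
  letI : Fintype (𝒪[F] ⧸ (absMaximalIdeal F).under 𝒪[F]) := Fintype.ofFinite _
  have hq : Fintype.card (𝒪[F] ⧸ (absMaximalIdeal F).under 𝒪[F]) = residueFieldCard F := by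
    rw [Fintype.card_eq_nat_card, card_quotient_under_absMaximalIdeal_holds F]
  obtain ⟨p, hpmon, hpdeg, hpeval, hpinv⟩ := exists_monic_eval_eq_zero_of_forall_smul_eq F N a ha
  -- push `p` to `k₁[X]`: every coefficient `c ∈ S^{Γ_F}` is `≡ e (mod 𝔓)` with `e ∈ 𝒪[F]`
  have hlift : p.map (Ideal.Quotient.mk (absMaximalIdeal F)) ∈
      lifts (algebraMap (𝒪[F] ⧸ (absMaximalIdeal F).under 𝒪[F])
        (absIntegers 𝒪[F] F ⧸ absMaximalIdeal F)) := by
    rw [lifts_iff_coeff_lifts]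
    intro n
    rw [coeff_map]
    obtain ⟨e, he⟩ :=
      exists_sub_algebraMap_mem_absMaximalIdeal_of_forall_smul_eq F (p.coeff n) (hpinv n)
    refine ⟨Ideal.Quotient.mk _ e, ?_⟩
    change Ideal.Quotient.mk (absMaximalIdeal F) (algebraMap 𝒪[F] (absIntegers 𝒪[F] F) e) =
      Ideal.Quotient.mk (absMaximalIdeal F) (p.coeff n)
    rw [Ideal.Quotient.eq, ← Ideal.neg_mem_iff, neg_sub]
    exact he
  obtain ⟨p₁, hp₁map, hp₁deg, hp₁mon⟩ := lifts_and_natDegree_eq_and_monic hlift (hpmon.map _)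
  have hroot : aeval (Ideal.Quotient.mk (absMaximalIdeal F) a) p₁ = 0 := by
    rw [aeval_def, eval₂_eq_eval_map, hp₁map, eval_map, eval₂_hom, hpeval, map_zero]
  have hdeg₁ : p₁.natDegree ≤ N.index := by
    rw [hp₁deg, hpmon.natDegree_map]
    exact hpdeg
  have := pow_card_pow_factorial_eq_of_monic p₁ hp₁mon hdeg₁ _ hroot
  rwa [hq] at this

/-! ### Lifting residue automorphisms to a closed subgroup of `Γ_F` -/

/-- **Lifting automorphisms of `S ⧸ 𝔓` to a closed subgroup `N ≤ Γ_F`.**  If a ring automorphism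
`β` of `S ⧸ 𝔓` fixes the residues of all `N`-invariant absolute integers, then `β` is induced by
some `τ ∈ N`: apply Mathlib's `Ideal.Quotient.stabilizerHom_surjective_of_profinite` to the
profinite group `N` acting (continuously, `S` discrete) on `S` with ring of invariants `S^N`.
Ref: Serre, *Local Fields* (1979), Ch. I §7, Prop. 20 (`D ↠ Aut` of the residue extension), in
the profinite form of Neukirch (1999), Ch. I §9, Prop. (9.4). [folklore] -/
theorem exists_mem_forall_mk_smul_eq (N : Subgroup (absoluteGaloisGroup F))
    (hN : IsClosed (N : Set (absoluteGaloisGroup F)))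
    (β : (absIntegers 𝒪[F] F ⧸ absMaximalIdeal F) ≃+* (absIntegers 𝒪[F] F ⧸ absMaximalIdeal F))
    (hβ : ∀ a : absIntegers 𝒪[F] F, (∀ τ ∈ N, τ • a = a) →
      β (Ideal.Quotient.mk _ a) = Ideal.Quotient.mk _ a) :
    ∃ τ ∈ N, ∀ x : absIntegers 𝒪[F] F,
      Ideal.Quotient.mk (absMaximalIdeal F) (τ • x) = β (Ideal.Quotient.mk _ x) := by
  classical
  let A : Subring (absIntegers 𝒪[F] F) := FixedPoints.subring (absIntegers 𝒪[F] F) N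
  haveI : Algebra.IsInvariant A (absIntegers 𝒪[F] F) N := ⟨fun b hb => ⟨⟨b, hb⟩, rfl⟩⟩
  haveI : SMulCommClass N A (absIntegers 𝒪[F] F) :=
    ⟨fun τ r s => show τ • ((r : absIntegers 𝒪[F] F) * s) = (r : absIntegers 𝒪[F] F) * τ • s by
      rw [smul_mul', show τ • (r : absIntegers 𝒪[F] F) = r from r.2 τ]⟩
  -- the compact group `N` acts continuously on the discrete ring `S`
  letI : TopologicalSpace (absIntegers 𝒪[F] F) := ⊥
  haveI : DiscreteTopology (absIntegers 𝒪[F] F) := ⟨rfl⟩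
  haveI : ContinuousSMul (absoluteGaloisGroup F) (absIntegers 𝒪[F] F) :=
    absIntegers.continuousSMul 𝒪[F]
  haveI : ContinuousSMul N (absIntegers 𝒪[F] F) :=
    ⟨(continuous_smul (M := absoluteGaloisGroup F) (X := absIntegers 𝒪[F] F)).comp
      (continuous_subtype_val.prodMap continuous_id)⟩
  haveI : CompactSpace (absoluteGaloisGroup F) := absoluteGaloisGroup_compactSpace F
  haveI : CompactSpace N := isCompact_iff_compactSpace.mp hN.isCompact
  haveI h𝔓 : (absMaximalIdeal F).IsMaximal := absMaximalIdeal_isMaximal_holds F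
  -- `β` as an automorphism over the residue ring of the invariants `A = S^N`
  let P : Ideal A := (absMaximalIdeal F).under A
  let β' : (absIntegers 𝒪[F] F ⧸ absMaximalIdeal F) ≃ₐ[A ⧸ P]
      (absIntegers 𝒪[F] F ⧸ absMaximalIdeal F) :=
    { β with
      commutes' := fun r => by
        obtain ⟨⟨a, ha⟩, rfl⟩ := Ideal.Quotient.mk_surjective r
        exact hβ a fun τ hτ => ha ⟨τ, hτ⟩ }
  obtain ⟨τ, hτ⟩ := Ideal.Quotient.stabilizerHom_surjective_of_profinite (G := N) P
    (absMaximalIdeal F) β'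
  refine ⟨(τ.1 : absoluteGaloisGroup F), τ.1.2, fun x => ?_⟩
  have h := AlgEquiv.congr_fun hτ (Ideal.Quotient.mk (absMaximalIdeal F) x)
  rw [Ideal.Quotient.stabilizerHom_apply] at h
  exact h

/-! ### The action of `σ ∈ Γ_F` on residues of `N`-invariants is a power of Frobenius -/

-- The intermediate field `k'` over the residue *ring* `𝒪[F] ⧸ 𝔓 ∩ 𝒪[F]` (a field only through the
-- local instance `Ideal.Quotient.field`) makes instance synthesis (`Module`, `Module.Finite` for
-- `↥k'`) and unification unusually expensive; the default limits do not suffice.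
set_option maxHeartbeats 400000 in
set_option synthInstance.maxHeartbeats 100000 in
/-- For a normal subgroup `N ⊴ Γ_F` of finite index and `σ ∈ Γ_F` there is `n` with
`σ a ≡ a ^ (q_F ^ n) (mod 𝔓)` for every `N`-invariant absolute integer `a`: the residues of the
`N`-invariants form a finite set (`mk_pow_residueFieldCard_pow_factorial_index`), stable under
`σ` (normality), generating a finite subfield `k'` of `S ⧸ 𝔓` on which `σ` acts as a
`𝓀[F]`-automorphism, hence as a power of the Frobenius `x ↦ x ^ q_F`
(`FiniteField.bijective_frobeniusAlgHom_pow`).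
Ref: Serre, *Local Fields* (1979), Ch. I §7, Prop. 21–22 and §8 (Galois groups of finite residue
extensions are generated by the Frobenius). [folklore] -/
theorem exists_forall_mk_smul_eq_pow (N : Subgroup (absoluteGaloisGroup F)) [N.Normal]
    [N.FiniteIndex] (σ : absoluteGaloisGroup F) :
    ∃ n : ℕ, ∀ a : absIntegers 𝒪[F] F, (∀ τ ∈ N, τ • a = a) →
      Ideal.Quotient.mk (absMaximalIdeal F) (σ • a) =
        Ideal.Quotient.mk (absMaximalIdeal F) a ^ residueFieldCard F ^ n := by
  classical
  -- the fields `κ = S ⧸ 𝔓` and `k₁ = 𝒪[F] ⧸ 𝔓 ∩ 𝒪[F]` (`#k₁ = q_F`)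
  haveI h𝔓 : (absMaximalIdeal F).IsMaximal := absMaximalIdeal_isMaximal_holds F
  letI := Ideal.Quotient.field (absMaximalIdeal F)
  haveI : ((absMaximalIdeal F).under 𝒪[F]).IsMaximal := Ideal.IsMaximal.under 𝒪[F] _
  letI := Ideal.Quotient.field ((absMaximalIdeal F).under 𝒪[F])
  haveI : Finite (𝒪[F] ⧸ (absMaximalIdeal F).under 𝒪[F]) := Nat.finite_of_card_ne_zero (by
    rw [card_quotient_under_absMaximalIdeal_holds F]
    exact residueFieldCard_ne_zero F)
  letI : Fintype (𝒪[F] ⧸ (absMaximalIdeal F).under 𝒪[F]) := Fintype.ofFinite _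
  have hq : Fintype.card (𝒪[F] ⧸ (absMaximalIdeal F).under 𝒪[F]) = residueFieldCard F := by
    rw [Fintype.card_eq_nat_card, card_quotient_under_absMaximalIdeal_holds F]
  -- the (finite) set of residues of `N`-invariants and the finite field `k'` it generates
  let kN : Set (absIntegers 𝒪[F] F ⧸ absMaximalIdeal F) :=
    {x | ∃ a : absIntegers 𝒪[F] F, (∀ τ ∈ N, τ • a = a) ∧ Ideal.Quotient.mk _ a = x}
  have hkN : kN.Finite := by
    refine (Polynomial.finite_setOf_isRoot (FiniteField.X_pow_card_pow_sub_X_ne_zero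
      (absIntegers 𝒪[F] F ⧸ absMaximalIdeal F) (Nat.factorial_pos N.index).ne'
      (one_lt_residueFieldCard F))).subset ?_
    rintro _ ⟨a, ha, rfl⟩
    simp only [Set.mem_setOf_eq, IsRoot.def, eval_sub, eval_pow, eval_X, sub_eq_zero]
    exact mk_pow_residueFieldCard_pow_factorial_index F N a ha
  haveI : Finite kN := hkN.to_subtype
  let k' : IntermediateField (𝒪[F] ⧸ (absMaximalIdeal F).under 𝒪[F])
      (absIntegers 𝒪[F] F ⧸ absMaximalIdeal F) := IntermediateField.adjoin _ kN
  haveI : FiniteDimensional (𝒪[F] ⧸ (absMaximalIdeal F).under 𝒪[F]) k' :=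
    IntermediateField.finiteDimensional_adjoin fun x _ => Algebra.IsIntegral.isIntegral x
  haveI : Finite k' := Module.finite_of_finite (𝒪[F] ⧸ (absMaximalIdeal F).under 𝒪[F])
  letI : Fintype k' := Fintype.ofFinite _
  -- `σ` acting on `κ` as a `k₁`-automorphism `ρ`
  have hσ : σ ∈ MulAction.stabilizer (absoluteGaloisGroup F) (absMaximalIdeal F) :=
    smul_absMaximalIdeal_holds F σ
  let ρ := Ideal.Quotient.stabilizerHom (absMaximalIdeal F) ((absMaximalIdeal F).under 𝒪[F])
    (absoluteGaloisGroup F) ⟨σ, hσ⟩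
  have hρ : ∀ x : absIntegers 𝒪[F] F,
      ρ (Ideal.Quotient.mk _ x) = Ideal.Quotient.mk _ (σ • x) := fun x =>
    Ideal.Quotient.stabilizerHom_apply _ _ _ ⟨σ, hσ⟩ x
  -- `ρ` maps `kN` into itself (`N` is normal), hence `k'` into itself
  have hρkN : ∀ x ∈ kN, ρ x ∈ kN := by
    rintro _ ⟨a, ha, rfl⟩
    refine ⟨σ • a, fun τ hτ => ?_, (hρ a).symm⟩
    have hconj : σ⁻¹ * τ * σ⁻¹⁻¹ ∈ N := Subgroup.Normal.conj_mem inferInstance τ hτ σ⁻¹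
    rw [inv_inv] at hconj
    calc τ • σ • a = σ • ((σ⁻¹ * τ * σ) • a) := by
          rw [mul_smul, mul_smul, smul_inv_smul]
      _ = σ • a := by rw [ha _ hconj]
  have hρk' : ∀ y : k', (ρ (y : absIntegers 𝒪[F] F ⧸ absMaximalIdeal F)) ∈ k' := by
    have hmap : k'.map ρ.toAlgHom ≤ k' := by
      rw [IntermediateField.adjoin_map]
      exact IntermediateField.adjoin.mono _ _ _ (by rintro _ ⟨x, hx, rfl⟩; exact hρkN x hx)
    exact fun y => hmap ⟨y, y.2, rfl⟩
  let r : k' →ₐ[𝒪[F] ⧸ (absMaximalIdeal F).under 𝒪[F]] k' :=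
    (ρ.toAlgHom.comp k'.val).codRestrict k'.toSubalgebra fun y => hρk' y
  -- `r` is a power of the Frobenius of the finite field `k'`
  obtain ⟨⟨n, hn⟩, hr⟩ := (FiniteField.bijective_frobeniusAlgHom_pow
    (𝒪[F] ⧸ (absMaximalIdeal F).under 𝒪[F]) k').2 r
  refine ⟨n, fun a ha => ?_⟩
  have hmem : Ideal.Quotient.mk (absMaximalIdeal F) a ∈ k' :=
    IntermediateField.subset_adjoin _ kN ⟨a, ha, rfl⟩
  have h1 := congrArg (fun f : k' →ₐ[𝒪[F] ⧸ (absMaximalIdeal F).under 𝒪[F]] k' =>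
    ((f ⟨_, hmem⟩ : k') : absIntegers 𝒪[F] F ⧸ absMaximalIdeal F)) hr
  simp only [AlgHom.coe_pow, FiniteField.coe_frobeniusAlgHom, pow_iterate] at h1
  rw [← hρ, ← hq]
  -- `h1 : ↑(⟨ā, _⟩ ^ (q ^ n)) = ↑(r ⟨ā, _⟩) = ρ ā`
  rw [SubmonoidClass.coe_pow] at h1
  exact h1.symm

/-! ### Density of the Weil group -/

/-- **Discharge of `WeilGroup.denseRange_toAbsGalois`**: the Weil group `W_F` is dense in `Γ_F`
(every characteristic).  Given `σ ∈ Γ_F` and a basic neighbourhood `σ · Gal(F̄/L)`, `L/F` finite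
normal, put `N = Gal(F̄/L)`; `σ` acts on the residues of the `N`-invariant absolute integers as
`x ↦ x ^ (q ^ n)` for some `n` (`exists_forall_mk_smul_eq_pow`), so the automorphism
`ρ(σ)⁻¹ ∘ Frob ^ n` of `S ⧸ 𝔓` fixes them and lifts to some `τ ∈ N`
(`exists_mem_forall_mk_smul_eq`); then `σ τ` acts as `Frob ^ n`, i.e. `σ τ ∈ W_F ∩ σ N`.
Ref: Tate, *Number theoretic background* (Corvallis 1979), (1.4.1) (`W_F` is dense in `Γ_F`);
Serre, *Local Fields* (1979), Ch. I §7–8. [cite: Corvallis1979, (1.4.1)] -/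
theorem WeilGroup.denseRange_toAbsGalois_holds : WeilGroup.denseRange_toAbsGalois F := by
  classical
  change Dense (Set.range (WeilGroup.toAbsGalois F))
  intro σ
  rw [mem_closure_iff_nhds]
  intro t ht
  -- a finite normal `L / F` with `σ · Gal(F̄/L) ⊆ t`
  have ht1 : (fun τ => σ * τ) ⁻¹' t ∈ nhds (1 : absoluteGaloisGroup F) :=
    (continuous_const.mul continuous_id).continuousAt.preimage_mem_nhds (by simpa using ht)
  obtain ⟨L, hLfin, hLnormal, hLt⟩ :=
    (krullTopology_mem_nhds_one_iff_of_normal F (AlgebraicClosure F) _).mp ht1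
  let N : Subgroup (absoluteGaloisGroup F) := L.fixingSubgroup
  haveI : N.Normal := by
    rw [show N = (AlgEquiv.restrictNormalHom L).ker from
      (IntermediateField.restrictNormalHom_ker L).symm]
    exact MonoidHom.normal_ker _
  haveI : CompactSpace (absoluteGaloisGroup F) := absoluteGaloisGroup_compactSpace F
  have hNopen : IsOpen (N : Set (absoluteGaloisGroup F)) :=
    IntermediateField.fixingSubgroup_isOpen L
  have hNclosed : IsClosed (N : Set (absoluteGaloisGroup F)) :=
    IntermediateField.fixingSubgroup_isClosed L
  haveI : Finite (absoluteGaloisGroup F ⧸ N) := Subgroup.quotient_finite_of_isOpen N hNopen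
  haveI : N.FiniteIndex := Subgroup.finiteIndex_of_finite_quotient
  -- `σ` acts on residues of `N`-invariants as `Frob ^ n`
  obtain ⟨n, hn⟩ := exists_forall_mk_smul_eq_pow F N σ
  -- the fields `κ = S ⧸ 𝔓`, `k₁ = 𝒪[F] ⧸ 𝔓 ∩ 𝒪[F]`, and the Frobenius `Φ = (x ↦ x ^ (q ^ n))`
  haveI h𝔓 : (absMaximalIdeal F).IsMaximal := absMaximalIdeal_isMaximal_holds F
  letI := Ideal.Quotient.field (absMaximalIdeal F)
  haveI : ((absMaximalIdeal F).under 𝒪[F]).IsMaximal := Ideal.IsMaximal.under 𝒪[F] _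
  letI := Ideal.Quotient.field ((absMaximalIdeal F).under 𝒪[F])
  haveI : Finite (𝒪[F] ⧸ (absMaximalIdeal F).under 𝒪[F]) := Nat.finite_of_card_ne_zero (by
    rw [card_quotient_under_absMaximalIdeal_holds F]
    exact residueFieldCard_ne_zero F)
  letI : Fintype (𝒪[F] ⧸ (absMaximalIdeal F).under 𝒪[F]) := Fintype.ofFinite _
  have hq : Fintype.card (𝒪[F] ⧸ (absMaximalIdeal F).under 𝒪[F]) = residueFieldCard F := by
    rw [Fintype.card_eq_nat_card, card_quotient_under_absMaximalIdeal_holds F]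
  obtain ⟨p, hchar⟩ := CharP.exists (𝒪[F] ⧸ (absMaximalIdeal F).under 𝒪[F])
  obtain ⟨f, hp, hf⟩ := FiniteField.card (𝒪[F] ⧸ (absMaximalIdeal F).under 𝒪[F]) p
  haveI : CharP (absIntegers 𝒪[F] F ⧸ absMaximalIdeal F) p :=
    charP_of_injective_algebraMap
      (algebraMap (𝒪[F] ⧸ (absMaximalIdeal F).under 𝒪[F]) _).injective p
  haveI : ExpChar (absIntegers 𝒪[F] F ⧸ absMaximalIdeal F) p := .prime hp
  haveI : Algebra.IsAlgebraic (𝒪[F] ⧸ (absMaximalIdeal F).under 𝒪[F])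
    (absIntegers 𝒪[F] F ⧸ absMaximalIdeal F) := Algebra.IsIntegral.isAlgebraic
  haveI : PerfectField (absIntegers 𝒪[F] F ⧸ absMaximalIdeal F) :=
    Algebra.IsAlgebraic.perfectField (𝒪[F] ⧸ (absMaximalIdeal F).under 𝒪[F])
  let Φ : (absIntegers 𝒪[F] F ⧸ absMaximalIdeal F) ≃+* (absIntegers 𝒪[F] F ⧸ absMaximalIdeal F) :=
    iterateFrobeniusEquiv _ p (f * n)
  have hΦ : ∀ x, Φ x = x ^ residueFieldCard F ^ n := fun x => by
    change iterateFrobenius _ p (f * n) x = _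
    rw [iterateFrobenius_def, pow_mul, ← hf, hq]
  -- `σ` on `κ`
  have hσ : σ ∈ MulAction.stabilizer (absoluteGaloisGroup F) (absMaximalIdeal F) :=
    smul_absMaximalIdeal_holds F σ
  let ρ := Ideal.Quotient.stabilizerHom (absMaximalIdeal F) ((absMaximalIdeal F).under 𝒪[F])
    (absoluteGaloisGroup F) ⟨σ, hσ⟩
  have hρ : ∀ x : absIntegers 𝒪[F] F,
      ρ (Ideal.Quotient.mk _ x) = Ideal.Quotient.mk _ (σ • x) := fun x =>
    Ideal.Quotient.stabilizerHom_apply _ _ _ ⟨σ, hσ⟩ x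
  -- `β = ρ⁻¹ ∘ Φ` fixes the residues of `N`-invariants, hence comes from some `τ ∈ N`
  let β : (absIntegers 𝒪[F] F ⧸ absMaximalIdeal F) ≃+* (absIntegers 𝒪[F] F ⧸ absMaximalIdeal F) :=
    Φ.trans ρ.toRingEquiv.symm
  have hβ : ∀ a : absIntegers 𝒪[F] F, (∀ τ ∈ N, τ • a = a) →
      β (Ideal.Quotient.mk _ a) = Ideal.Quotient.mk _ a := fun a ha => by
    change ρ.toRingEquiv.symm (Φ (Ideal.Quotient.mk _ a)) = _
    rw [RingEquiv.symm_apply_eq, hΦ, ← hn a ha, ← hρ]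
    rfl
  obtain ⟨τ, hτN, hτ⟩ := exists_mem_forall_mk_smul_eq F N hNclosed β hβ
  -- `w = σ τ ∈ t ∩ W_F`
  refine ⟨σ * τ, hLt hτN, ?_⟩
  rw [← MonoidHom.coe_range, WeilGroup.range_toAbsGalois, SetLike.mem_coe]
  refine mem_weilSubgroup_of_isFrobPow (n := (n : ℤ)) ?_
  rw [isFrobPow_natCast_iff]
  intro x
  refine Ideal.Quotient.eq.mp ?_
  rw [mul_smul, ← hρ, hτ, map_pow]
  change ρ (ρ.toRingEquiv.symm (Φ (Ideal.Quotient.mk _ x))) = _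
  rw [hΦ]
  exact ρ.toRingEquiv.apply_symm_apply _

end Literature.NumberTheory.GaloisRepresentations
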